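import Mathlib.MeasureTheory.Integral.IntervalIntegral.FundThmCalculus
import Mathlib.MeasureTheory.Function.L2Space
import Literature.Analysis.FunctionSpaces.TorusSpaceTime
import Literature.Analysis.FunctionSpaces.TorusFourierCalculus
import Literature.Analysis.FunctionSpaces.TorusFluidGlueProofs
import Literature.Analysis.FluidPDE.WeakSolutionProofs
import Literature.Analysis.FluidPDE.TorusClassicalLerayHopf
import HarnessLib

/-!
# Discharged fact: global classical solutions on `T^d` are global Leray–Hopf solutions

`Literature.Analysis.FluidPDE.TorusClassicalLerayHopf` records as the named fact
`Torus.isGlobalLerayHopf_of_isClassicalNSSolutionOn` that a classical solution `(u, p)` of the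
forced Navier–Stokes system on all of `ℝ × 𝕋³` with jointly smooth force is a global Leray–Hopf
weak solution with datum `u 0`. It is proved here
(`Torus.isGlobalLerayHopf_of_isClassicalNSSolutionOn_holds`), in every dimension and for every
convex time set `S ⊇ [0, T]` (`Torus.IsClassicalNSSolutionOn.isLerayHopfOn_of_convex`),
following Robinson–Rodrigo–Sadowski 2016: §3.1 (PDF pp. 58–59: classical solutions satisfy the
weak formulation (3.1), by integration by parts — here the discharged
`Torus.IsClassicalNSSolutionOn.isWeakNSSolutionForcedOn_holds`), eq. (3.2) and Thm. 6.5 (PDF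
p. 101: strong, a fortiori classical, solutions satisfy the energy *equality*
`½‖u(t)‖² + ν ∫ₛᵗ ‖∇u‖² = ½‖u(s)‖² + ∫ₛᵗ ⟨f, u⟩`, "so every strong solution must also be a
Leray–Hopf weak solution", Def. 4.9), the energy equality being the time integral of the
discharged energy balance `Torus.IsClassicalNSSolutionOn.energy_balance_holds` (Doering–Foias
2002, §2, (2.4)); the remaining clauses of the Leray–Hopf definition (Galdi 2000, Def. 2.1:
`L^∞L²`, `L²H¹`, weak `L²` continuity, strong attainment of the datum) hold on the compact
`[0, T] × T^d` by joint continuity, the `H¹` norm being computed spectrally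
(`Torus.eSobolevNorm_one_complexify_sq`, `Torus.eGradNormSq_eq_ofReal_gradNormSq`: Parseval).

Also proved: the force of a classical solution is jointly smooth on time sets of unique
differentiability (the file-private `Torus.IsClassicalNSSolutionOn.isSmoothSpaceTimeOn_force`,
from the momentum equation — the torus twin of the whole-space
`Literature.Analysis.FluidPDE.IsClassicalNSSolutionOn.isSmoothSpaceTimeOn_force` of `ClassicalSolutionCalculus`),
so the smoothness hypothesis on `f` in the named fact is redundant; the integrated energy
equality `Torus.IsClassicalNSSolutionOn.energy_eq`; and the `L²`-continuity lemmas
`Torus.IsSmoothSpaceTimeOn.continuousOn_integral_inner` (weak) and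
`Torus.IsSmoothSpaceTimeOn.tendsto_eLpNorm_sub` (strong).

## References

* J. C. Robinson, J. L. Rodrigo, W. Sadowski, *The Three-Dimensional Navier–Stokes Equations*,
  CUP 2016, §3.1 and (3.2) (PDF pp. 58–59), Def. 4.9 (PDF p. 80), Thm. 6.5 (PDF p. 101).
  [RobinsonRodrigoSadowski2016]
* G. P. Galdi, *An introduction to the Navier–Stokes initial-boundary value problem*, in:
  Fundamental Directions in Mathematical Fluid Mechanics, Birkhäuser 2000, Def. 2.1, Thm. 4.1.
* C. R. Doering, C. Foias, *Energy dissipation in body-forced turbulence*, J. Fluid Mech. 467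
  (2002), §2, eq. (2.4).
-/

open MeasureTheory Set Topology Filter
open scoped InnerProductSpace ContDiff ENNReal NNReal

noncomputable section

namespace Literature.Analysis.FluidPDE

namespace Torus

variable {d : Type*} [Fintype d] [DecidableEq d]

/-! ## `L²` glue for jointly smooth fields -/

section Glue

variable {S : Set ℝ} {u : ℝ → UnitAddTorus d → EuclideanSpace ℝ d}

omit [DecidableEq d] in
/-- Squared norms of jointly smooth fields are jointly smooth. [folklore] -/
theorem _root_.Literature.Analysis.FunctionSpaces.Torus.IsSmoothSpaceTimeOn.normSq {E : Type*} [NormedAddCommGroup E] [InnerProductSpace ℝ E]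
    {a : ℝ → UnitAddTorus d → E} (ha : FunctionSpaces.Torus.IsSmoothSpaceTimeOn S a) :
    FunctionSpaces.Torus.IsSmoothSpaceTimeOn S (fun t x => ‖a t x‖ ^ 2) :=
  ContDiffOn.norm_sq ℝ ha

omit [DecidableEq d] in
/-- **Uniform `L²` bound on compact time sets**: a jointly smooth field on `S × T^d` has
`∫ ‖u(t)‖ₑ² ≤ C` for all `t` in a compact `K ⊆ S` (boundedness on the compact `K × T^d`;
Galdi 2000, Def. 2.1 (i) for classical solutions). [folklore] -/
theorem _root_.Literature.Analysis.FunctionSpaces.Torus.IsSmoothSpaceTimeOn.exists_lintegral_enorm_sq_le (hu : FunctionSpaces.Torus.IsSmoothSpaceTimeOn S u) {K : Set ℝ}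
    (hK : IsCompact K) (hKS : K ⊆ S) : ∃ C : ℝ≥0, ∀ t ∈ K, ∫⁻ x, ‖u t x‖ₑ ^ 2 ≤ C := by
  obtain ⟨C, hC⟩ := hu.exists_norm_le_of_isCompact hK hKS
  refine ⟨C.toNNReal ^ 2, fun t ht => ?_⟩
  calc ∫⁻ x, ‖u t x‖ₑ ^ 2 ≤ ∫⁻ _, ENNReal.ofReal C ^ 2 := lintegral_mono fun x => by
          gcongr
          rw [← ofReal_norm]
          exact ENNReal.ofReal_le_ofReal (hC t ht x)
    _ = ENNReal.ofReal C ^ 2 := by rw [lintegral_const, measure_univ, mul_one]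
    _ = ((C.toNNReal ^ 2 : ℝ≥0) : ℝ≥0∞) := by rw [ENNReal.coe_pow]; rfl

omit [DecidableEq d] in
/-- Inner products of a continuous field with an `L²` field on the torus are integrable
(`L² ⊆ L¹` on the probability space `T^d`). [folklore] -/
theorem integrable_inner_of_continuous_of_memLp {v w : UnitAddTorus d → EuclideanSpace ℝ d}
    (hv : Continuous v) (hw : MemLp w 2 volume) : Integrable (fun x => ⟪v x, w x⟫_ℝ) volume := by
  obtain ⟨C, hC⟩ : ∃ C, ∀ x, ‖v x‖ ≤ C := by
    obtain ⟨C, hC⟩ := (isCompact_range hv).isBounded.exists_norm_le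
    exact ⟨C, fun x => hC _ (mem_range_self x)⟩
  have hw1 : Integrable w volume := hw.integrable one_le_two
  refine Integrable.mono' (hw1.norm.const_mul C)
    (hv.aestronglyMeasurable.inner hw.aestronglyMeasurable) (ae_of_all _ fun x => ?_)
  calc ‖⟪v x, w x⟫_ℝ‖ ≤ ‖v x‖ * ‖w x‖ := norm_inner_le_norm _ _
    _ ≤ C * ‖w x‖ := by gcongr; exact hC x

omit [DecidableEq d] in
/-- **Weak `L²` continuity of jointly smooth fields**: for `w ∈ L²(T^d)`, `t ↦ ∫ ⟪u(t), w⟫` is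
continuous on `S` (uniform convergence `u(s) → u(t)` on the compact torus,
`Torus.IsSmoothSpaceTimeOn.eventually_norm_sub_lt`; Galdi 2000, Lemma 2.2 for classical
solutions). [folklore] -/
theorem _root_.Literature.Analysis.FunctionSpaces.Torus.IsSmoothSpaceTimeOn.continuousOn_integral_inner (hu : FunctionSpaces.Torus.IsSmoothSpaceTimeOn S u)
    {w : UnitAddTorus d → EuclideanSpace ℝ d} (hw : MemLp w 2 volume) :
    ContinuousOn (fun t => ∫ x, ⟪u t x, w x⟫_ℝ) S := by
  intro t ht
  have hw1 : Integrable (fun x => ‖w x‖) volume := (hw.integrable one_le_two).norm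
  set W : ℝ := ∫ x, ‖w x‖ with hW
  have hW0 : 0 ≤ W := integral_nonneg fun x => norm_nonneg _
  refine Metric.continuousWithinAt_iff'.2 fun ε hε => ?_
  have hδ : 0 < ε / (W + 1) := div_pos hε (by linarith)
  filter_upwards [hu.eventually_norm_sub_lt ht hδ, self_mem_nhdsWithin] with s hs hsS
  have his : Integrable (fun x => ⟪u s x, w x⟫_ℝ) volume :=
    integrable_inner_of_continuous_of_memLp (hu.isSmooth_slice hsS).continuous hw
  have hit : Integrable (fun x => ⟪u t x, w x⟫_ℝ) volume :=
    integrable_inner_of_continuous_of_memLp (hu.isSmooth_slice ht).continuous hw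
  rw [dist_eq_norm, ← integral_sub his hit]
  calc ‖∫ x, (⟪u s x, w x⟫_ℝ - ⟪u t x, w x⟫_ℝ)‖
      ≤ ∫ x, ε / (W + 1) * ‖w x‖ := by
        refine norm_integral_le_of_norm_le (hw1.const_mul _) (ae_of_all _ fun x => ?_)
        rw [← inner_sub_left]
        calc ‖⟪u s x - u t x, w x⟫_ℝ‖ ≤ ‖u s x - u t x‖ * ‖w x‖ := norm_inner_le_norm _ _
          _ ≤ ε / (W + 1) * ‖w x‖ := by gcongr; exact (hs x).le
    _ = ε / (W + 1) * W := integral_const_mul _ _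
    _ < ε := by
        rw [div_mul_eq_mul_div, div_lt_iff₀ (by linarith)]
        nlinarith

omit [DecidableEq d] in
/-- **Strong `L²` continuity of jointly smooth fields**: `‖u(s) - u(t)‖_{L²} → 0` as `s → t`
within `S` (uniform convergence on the compact torus of measure one). [folklore] -/
theorem _root_.Literature.Analysis.FunctionSpaces.Torus.IsSmoothSpaceTimeOn.tendsto_eLpNorm_sub (hu : FunctionSpaces.Torus.IsSmoothSpaceTimeOn S u) {t : ℝ}
    (ht : t ∈ S) : Tendsto (fun s => eLpNorm (u s - u t) 2 volume) (𝓝[S] t) (𝓝 0) := by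
  refine ENNReal.tendsto_nhds_zero.2 fun ε hε => ?_
  by_cases hε' : ε = ⊤
  · exact Eventually.of_forall fun s => hε' ▸ le_top
  have hδ : 0 < ε.toReal := ENNReal.toReal_pos hε.ne' hε'
  filter_upwards [hu.eventually_norm_sub_lt ht hδ] with s hs
  calc eLpNorm (u s - u t) 2 volume
      ≤ (volume : Measure (UnitAddTorus d)) univ ^ (2 : ℝ≥0∞).toReal⁻¹ * ENNReal.ofReal ε.toReal :=
        eLpNorm_le_of_ae_bound (ae_of_all _ fun x => by rw [Pi.sub_apply]; exact (hs x).le)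
    _ = ε := by rw [measure_univ, ENNReal.one_rpow, one_mul, ENNReal.ofReal_toReal hε']

/-- **`L²(a, b; H¹)` membership of jointly smooth fields** on compact time intervals
`[a, b] ⊆ S` (for `S` of unique differentiability): every slice is in `H¹` and
`t ↦ ‖u(t)‖²_{H¹} = ∫ ‖u(t)‖² + (4π²)⁻¹ ‖∇u(t)‖₂²` (`Torus.eSobolevNorm_one_complexify_sq`) is
bounded on `[a, b]` (Temam, Ch. III, Thm. 3.1 for the class; trivial for classical fields). [folklore] -/
theorem _root_.Literature.Analysis.FunctionSpaces.Torus.IsSmoothSpaceTimeOn.memL2Sobolev_one (hu : FunctionSpaces.Torus.IsSmoothSpaceTimeOn S u) (hU : UniqueDiffOn ℝ S)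
    {a b : ℝ} (hab : Icc a b ⊆ S) : FunctionSpaces.Torus.MemL2Sobolev a b 1 (fun t => FunctionSpaces.EuclideanSpace.complexify ∘ u t) := by
  have hIoo : Ioo a b ⊆ S := Ioo_subset_Icc_self.trans hab
  refine ⟨(ae_restrict_iff' measurableSet_Ioo).2 (ae_of_all _ fun t ht =>
    (hu.isSmooth_slice (hIoo ht)).memSobolev_one_complexify), ?_⟩
  -- uniform bounds on `u` and on the partial derivatives over `[a, b] × T^d`
  obtain ⟨C₀, hC₀⟩ := hu.exists_norm_le_of_isCompact isCompact_Icc hab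
  have hCi : ∀ i, ∃ C : ℝ, ∀ t ∈ Icc a b, ∀ x, ‖FunctionSpaces.Torus.partialDeriv i (u t) x‖ ≤ C := fun i =>
    (hu.partialDeriv hU i).exists_norm_le_of_isCompact isCompact_Icc hab
  choose C hC using hCi
  set M : ℝ := C₀ ^ 2 + (4 * Real.pi ^ 2)⁻¹ * ∑ i, C i ^ 2 with hM
  have hbound : ∀ t ∈ Ioo a b,
      FunctionSpaces.Torus.eSobolevNorm 1 (FunctionSpaces.EuclideanSpace.complexify ∘ u t) ^ 2 ≤ ENNReal.ofReal M := by
    intro t ht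
    have htI : t ∈ Icc a b := Ioo_subset_Icc_self ht
    have hut : FunctionSpaces.Torus.IsSmooth (u t) := hu.isSmooth_slice (hIoo ht)
    rw [FunctionSpaces.Torus.eSobolevNorm_one_complexify_sq hut]
    refine ENNReal.ofReal_le_ofReal (add_le_add ?_ (mul_le_mul_of_nonneg_left ?_ (by positivity)))
    · calc ∫ x, ‖u t x‖ ^ 2 ≤ ∫ _ : UnitAddTorus d, C₀ ^ 2 := by
            refine integral_mono hut.norm_sq.integrable (integrable_const _) fun x => ?_
            have h0 : 0 ≤ ‖u t x‖ := norm_nonneg _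
            have h1 := hC₀ t htI x
            nlinarith
        _ = C₀ ^ 2 := by simp
    · calc FunctionSpaces.Torus.gradNormSq (u t) ≤ ∫ _ : UnitAddTorus d, ∑ i, C i ^ 2 := by
            refine integral_mono ?_ (integrable_const _) fun x => ?_
            · exact integrable_finsetSum _ fun i _ => (hut.partialDeriv i).norm_sq.integrable
            · refine Finset.sum_le_sum fun i _ => ?_
              have h0 : 0 ≤ ‖FunctionSpaces.Torus.partialDeriv i (u t) x‖ := norm_nonneg _
              have h1 := hC i t htI x
              nlinarith
        _ = ∑ i, C i ^ 2 := by simp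
  refine ENNReal.rpow_lt_top_of_nonneg (by norm_num) (lt_top_iff_ne_top.1 ?_)
  calc ∫⁻ t in Ioo a b, FunctionSpaces.Torus.eSobolevNorm 1 (FunctionSpaces.EuclideanSpace.complexify ∘ u t) ^ 2
      ≤ ∫⁻ _ in Ioo a b, ENNReal.ofReal M := setLIntegral_mono' measurableSet_Ioo hbound
    _ = ENNReal.ofReal M * volume (Ioo a b) := setLIntegral_const _ _
    _ < ⊤ := ENNReal.mul_lt_top ENNReal.ofReal_lt_top
        (by rw [Real.volume_Ioo]; exact ENNReal.ofReal_lt_top)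

/-- `t ↦ ‖∇u(t)‖₂²` is continuous on a convex time set of unique differentiability, for
jointly smooth `u` (space integral of the jointly smooth `∑ᵢ ‖∂ᵢu‖²`). [folklore] -/
theorem _root_.Literature.Analysis.FunctionSpaces.Torus.IsSmoothSpaceTimeOn.continuousOn_gradNormSq (hu : FunctionSpaces.Torus.IsSmoothSpaceTimeOn S u)
    (hSc : Convex ℝ S) (hU : UniqueDiffOn ℝ S) : ContinuousOn (fun t => FunctionSpaces.Torus.gradNormSq (u t)) S := by
  have hG : FunctionSpaces.Torus.IsSmoothSpaceTimeOn S (fun t x => ∑ i, ‖FunctionSpaces.Torus.partialDeriv i (u t) x‖ ^ 2) :=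
    FunctionSpaces.Torus.IsSmoothSpaceTimeOn.sum fun i _ => (hu.partialDeriv hU i).normSq
  exact hG.continuousOn_integral hSc

/-- For smooth slices the spectral dissipation `(∫⁻_{(s,t)} eGradNormSq (u τ)).toReal` is the
classical `∫ₛᵗ ‖∇u(τ)‖₂² dτ` (`Torus.eGradNormSq_eq_ofReal_gradNormSq` slice-wise, and
continuity of `τ ↦ ‖∇u(τ)‖₂²` on `[s, t]`). [folklore] -/
theorem _root_.Literature.Analysis.FunctionSpaces.Torus.IsSmoothSpaceTimeOn.toReal_lintegral_eGradNormSq (hu : FunctionSpaces.Torus.IsSmoothSpaceTimeOn S u)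
    (hSc : Convex ℝ S) (hU : UniqueDiffOn ℝ S) {s t : ℝ} (hst : s ≤ t) (hI : Icc s t ⊆ S) :
    (∫⁻ τ in Ioo s t, FunctionSpaces.Torus.eGradNormSq (u τ)).toReal = ∫ τ in s..t, FunctionSpaces.Torus.gradNormSq (u τ) := by
  have hIoo : Ioo s t ⊆ S := Ioo_subset_Icc_self.trans hI
  have h1 : ∫⁻ τ in Ioo s t, FunctionSpaces.Torus.eGradNormSq (u τ) =
      ∫⁻ τ in Ioo s t, ENNReal.ofReal (FunctionSpaces.Torus.gradNormSq (u τ)) :=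
    setLIntegral_congr_fun measurableSet_Ioo fun τ hτ =>
      FunctionSpaces.Torus.eGradNormSq_eq_ofReal_gradNormSq (hu.isSmooth_slice (hIoo hτ))
  have hint : IntegrableOn (fun τ => FunctionSpaces.Torus.gradNormSq (u τ)) (Ioo s t) volume :=
    (((hu.continuousOn_gradNormSq hSc hU).mono hI).integrableOn_compact isCompact_Icc).mono_set
      Ioo_subset_Icc_self
  rw [h1, ← ofReal_integral_eq_lintegral_ofReal hint
      (Eventually.of_forall fun τ => FunctionSpaces.Torus.gradNormSq_nonneg _),
    ENNReal.toReal_ofReal (setIntegral_nonneg measurableSet_Ioo fun τ _ => FunctionSpaces.Torus.gradNormSq_nonneg _),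
    intervalIntegral.integral_of_le hst, integral_Ioc_eq_integral_Ioo]

end Glue

/-! ## Classical solutions: smooth force, energy equality, Leray–Hopf -/

section Classical

variable {S : Set ℝ} {T ν : ℝ} {f u : ℝ → UnitAddTorus d → EuclideanSpace ℝ d}
  {p : ℝ → UnitAddTorus d → ℝ}

/-- The force of a classical solution is jointly smooth on the time set (of unique
differentiability): `f = ∂ₜu + (u·∇)u − νΔu + ∇p` on `S × T^d` by the momentum equation, and
the right-hand side is jointly smooth (`TorusSpaceTime`). File-private helper: the torus twin of
the whole-space `Literature.Analysis.FluidPDE.IsClassicalNSSolutionOn.isSmoothSpaceTimeOn_force`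
(`ClassicalSolutionCalculus`), same statement and proof. [folklore] -/
private theorem _root_.Literature.Analysis.FunctionSpaces.Torus.IsClassicalNSSolutionOn.isSmoothSpaceTimeOn_force
    (h : FunctionSpaces.Torus.IsClassicalNSSolutionOn S ν f u p) (hU : UniqueDiffOn ℝ S) :
    FunctionSpaces.Torus.IsSmoothSpaceTimeOn S f := by
  have hu := h.smooth_velocity
  have hG : FunctionSpaces.Torus.IsSmoothSpaceTimeOn S (fun t x => FunctionSpaces.Torus.timeDerivWithin S u t x + FunctionSpaces.Torus.convect (u t) (u t) x -
      ν • FunctionSpaces.Torus.laplacian (u t) x + FunctionSpaces.Torus.gradient (p t) x) :=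
    (((hu.timeDerivWithin hU).add (hu.convect hu hU)).sub ((hu.laplacian hU).const_smul ν)).add
      (h.smooth_pressure.gradient hU)
  refine ContDiffOn.congr hG fun z hz => ?_
  obtain ⟨t, y⟩ := z
  have ht : t ∈ S := (mem_prod.1 hz).1
  simp only [FunctionSpaces.Torus.stLift_apply]
  rw [h.momentum t ht (FunctionSpaces.Torus.proj y)]
  abel

/-- **Energy equality for classical solutions** on a convex time set:
`½‖u(t)‖² + ν ∫ₛᵗ ‖∇u‖₂² = ½‖u(s)‖² + ∫ₛᵗ ∫ ⟪f, u⟫` for `[s, t] ⊆ S` (Robinson–Rodrigo–Sadowski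
2016, (3.2) and Thm. 6.5; Doering–Foias 2002, §2: the time integral of the energy balance
`Torus.IsClassicalNSSolutionOn.energy_balance_holds`, by the fundamental theorem of calculus,
the derivative `−ν‖∇u‖₂² + ∫ ⟪f, u⟫` being continuous in time). [cite: RobinsonRodrigoSadowski2016, Thm. 6.5] -/
theorem _root_.Literature.Analysis.FunctionSpaces.Torus.IsClassicalNSSolutionOn.energy_eq (h : FunctionSpaces.Torus.IsClassicalNSSolutionOn S ν f u p) (hSc : Convex ℝ S)
    {s t : ℝ} (hst : s ≤ t) (hI : Icc s t ⊆ S) :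
    FunctionSpaces.Torus.kineticEnergy (u t) + ν * ∫ τ in s..t, FunctionSpaces.Torus.gradNormSq (u τ) =
      FunctionSpaces.Torus.kineticEnergy (u s) + ∫ τ in s..t, ∫ x, ⟪f τ x, u τ x⟫_ℝ := by
  rcases eq_or_lt_of_le hst with rfl | hst'
  · simp
  have hU : UniqueDiffOn ℝ S := by
    refine uniqueDiffOn_convex hSc ((nonempty_Ioo.2 hst').mono ?_)
    rw [← interior_Icc]
    exact interior_mono hI
  have hu := h.smooth_velocity
  have hf : FunctionSpaces.Torus.IsSmoothSpaceTimeOn S f := h.isSmoothSpaceTimeOn_force hU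
  set D : ℝ → ℝ := fun τ => -ν * FunctionSpaces.Torus.gradNormSq (u τ) + ∫ x, ⟪f τ x, u τ x⟫_ℝ with hD
  have hderiv : ∀ τ ∈ S, HasDerivWithinAt (fun σ => FunctionSpaces.Torus.kineticEnergy (u σ)) (D τ) S τ :=
    fun τ hτ => FunctionSpaces.Torus.IsClassicalNSSolutionOn.energy_balance_holds h hSc hτ
  have hGc : ContinuousOn (fun τ => FunctionSpaces.Torus.gradNormSq (u τ)) (Icc s t) :=
    (hu.continuousOn_gradNormSq hSc hU).mono hI
  have hFc : ContinuousOn (fun τ => ∫ x, ⟪f τ x, u τ x⟫_ℝ) (Icc s t) :=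
    ((hf.inner hu).continuousOn_integral hSc).mono hI
  have hGi : IntervalIntegrable (fun τ => FunctionSpaces.Torus.gradNormSq (u τ)) volume s t :=
    (hGc.mono (uIcc_of_le hst).subset).intervalIntegrable
  have hFi : IntervalIntegrable (fun τ => ∫ x, ⟪f τ x, u τ x⟫_ℝ) volume s t :=
    (hFc.mono (uIcc_of_le hst).subset).intervalIntegrable
  have hFTC : ∫ τ in s..t, D τ = FunctionSpaces.Torus.kineticEnergy (u t) - FunctionSpaces.Torus.kineticEnergy (u s) :=
    intervalIntegral.integral_eq_sub_of_hasDerivAt_of_le hst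
      (fun τ hτ => ((hderiv τ (hI hτ)).continuousWithinAt).mono hI)
      (fun τ hτ => (hderiv τ (hI (Ioo_subset_Icc_self hτ))).hasDerivAt
        (mem_of_superset (Icc_mem_nhds hτ.1 hτ.2) hI))
      ((hGi.const_mul (-ν)).add hFi)
  rw [intervalIntegral.integral_add (hGi.const_mul (-ν)) hFi, intervalIntegral.integral_const_mul]
    at hFTC
  linarith

/-- **Classical solutions are Leray–Hopf solutions on the torus.** A classical solution of the
forced Navier–Stokes system on a convex time set `S ⊇ [0, T]`, `T > 0`, is a Leray–Hopf weak
solution on `T^d × [0, T)` with datum `u 0` (Robinson–Rodrigo–Sadowski 2016, Thm. 6.5 with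
Def. 4.9: energy equality, hence "every strong solution must also be a Leray–Hopf weak
solution"; Galdi 2000, Def. 2.1 / Thm. 4.1): the weak formulation is
`Torus.IsClassicalNSSolutionOn.isWeakNSSolutionForcedOn_holds`, the energy inequalities are the
energy equality `Torus.IsClassicalNSSolutionOn.energy_eq` (dissipation identified spectrally by
`Torus.eGradNormSq_eq_ofReal_gradNormSq`), and `L^∞L²`, `L²H¹`, weak and strong `L²`
continuity hold by joint continuity on the compact `[0, T] × T^d`. The hypothesis `0 < T` is
needed for the `𝓝[>] 0`-limits, which are not restricted by `T`. [cite: RobinsonRodrigoSadowski2016, Thm. 6.5] -/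
theorem _root_.Literature.Analysis.FunctionSpaces.Torus.IsClassicalNSSolutionOn.isLerayHopfOn_of_convex (h : FunctionSpaces.Torus.IsClassicalNSSolutionOn S ν f u p)
    (hSc : Convex ℝ S) (hT : 0 < T) (hS : Icc 0 T ⊆ S) : IsLerayHopfOn T ν f (u 0) u := by
  have hu := h.smooth_velocity
  have h0 : (0 : ℝ) ∈ S := hS ⟨le_rfl, hT.le⟩
  have hU : UniqueDiffOn ℝ S := by
    refine uniqueDiffOn_convex hSc ((nonempty_Ioo.2 hT).mono ?_)
    rw [← interior_Icc]
    exact interior_mono hS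
  -- `𝓝[>] 0 ≤ 𝓝[S] 0` since `(0, T) ⊆ S`
  have hnhds : 𝓝[>] (0 : ℝ) ≤ 𝓝[S] 0 := by
    rw [← nhdsWithin_Ioo_eq_nhdsGT hT]
    exact nhdsWithin_mono _ (Ioo_subset_Icc_self.trans hS)
  have hineq : ∀ {s t : ℝ}, s ≤ t → Icc s t ⊆ S →
      FunctionSpaces.Torus.kineticEnergy (u t) + ν * (∫⁻ τ in Ioo s t, FunctionSpaces.Torus.eGradNormSq (u τ)).toReal ≤
        FunctionSpaces.Torus.kineticEnergy (u s) + ∫ τ in s..t, ∫ x, ⟪f τ x, u τ x⟫_ℝ := fun hst hI => by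
    rw [hu.toReal_lintegral_eGradNormSq hSc hU hst hI]
    exact (h.energy_eq hSc hst hI).le
  refine ⟨?_, ?_, ?_, ?_, ?_, ?_, ?_, ?_⟩
  -- weak formulation with datum
  · exact FunctionSpaces.Torus.IsClassicalNSSolutionOn.isWeakNSSolutionForcedOn_holds h hS
  -- `L^∞(0,T; L²)`
  · obtain ⟨C, hC⟩ := hu.exists_lintegral_enorm_sq_le isCompact_Icc hS
    exact ⟨C, (ae_restrict_iff' measurableSet_Ioo).2 (ae_of_all _ fun t ht =>
      hC t (Ioo_subset_Icc_self ht))⟩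
  -- every slice is `L²`
  · exact fun t ht => (hu.isSmooth_slice (hS ht)).memLp 2
  -- `L²(0,T; H¹)`
  · exact hu.memL2Sobolev_one hU hS
  -- energy inequality from `0`
  · exact fun t ht => hineq ht.1 (fun τ hτ => hS ⟨hτ.1, hτ.2.trans ht.2⟩)
  -- energy inequality from every `s ∈ (0, T)`
  · exact (ae_restrict_iff' measurableSet_Ioo).2 (ae_of_all _ fun s hs t ht =>
      hineq ht.1 (fun τ hτ => hS ⟨hs.1.le.trans hτ.1, hτ.2.trans ht.2⟩))
  -- weak `L²` continuity on `(0, T]` and at `0⁺`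
  · intro w hw
    have hc := hu.continuousOn_integral_inner hw
    exact ⟨hc.mono fun t ht => hS ⟨ht.1.le, ht.2⟩, ((hc 0 h0).tendsto).mono_left hnhds⟩
  -- strong attainment of the datum
  · exact (hu.tendsto_eLpNorm_sub h0).mono_left hnhds

/-- **Global classical solutions are global Leray–Hopf solutions** (every dimension): a classical
solution on all of `ℝ × T^d` is Leray–Hopf on `[0, T)` for every `T > 0` with datum `u 0`
(Robinson–Rodrigo–Sadowski 2016, Thm. 6.5 / Def. 4.9). [cite: RobinsonRodrigoSadowski2016, Thm. 6.5] -/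
theorem _root_.Literature.Analysis.FunctionSpaces.Torus.IsClassicalNSSolutionOn.isGlobalLerayHopf (h : FunctionSpaces.Torus.IsClassicalNSSolutionOn univ ν f u p) :
    IsGlobalLerayHopf ν f (u 0) u :=
  fun _ hT => h.isLerayHopfOn_of_convex convex_univ hT (subset_univ _)

end Classical

/-- **Discharge** of the named fact `Torus.isGlobalLerayHopf_of_isClassicalNSSolutionOn`
(`TorusClassicalLerayHopf`): for `ν > 0`, a classical solution `(u, p)` of the forced
Navier–Stokes system on all of `ℝ × 𝕋³` with jointly smooth force is a global Leray–Hopf weak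
solution with datum `u 0` (Robinson–Rodrigo–Sadowski 2016, Thm. 6.5, PDF p. 101, with Def. 4.9
and §3.1; Galdi 2000, Thm. 4.1). The hypotheses `0 < ν` and `IsSmoothSpaceTimeOn univ f` of the
fact are not used (the latter follows from the momentum equation, see the file-private
`Torus.IsClassicalNSSolutionOn.isSmoothSpaceTimeOn_force`). [cite: RobinsonRodrigoSadowski2016, Thm. 6.5] -/
theorem isGlobalLerayHopf_of_isClassicalNSSolutionOn_holds :
    isGlobalLerayHopf_of_isClassicalNSSolutionOn :=
  fun _ν _f _u _p _hν h _hf => h.isGlobalLerayHopf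

end Torus

end Literature.Analysis.FluidPDE
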